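import Literature.Geometry.Kaehler.AnalyticSetIsolatingPlanes
import HarnessLib

/-!
# Existence of proper projections (Chirka §3.4 Lemma 2): discharge of the named fact

This file proves `Literature.Geometry.Kaehler.SCV.exists_continuousLinearEquiv_forall_isCompact_inter_preimage`
([Chirka1989, §3.4 Lemma 2, p. 34], vendored in `Literature/Geometry/Kaehler/AnalyticSetProjection.lean`):
*given an analytic set `A ∋ a` of dimension `≤ p` at `a` (all regular points of `A` near `a` have
codimension `≥ dim E - p`) and finitely many linear surjections `m i : E → ℂᵖ`, there is one
linear automorphism `l` of `E` such that every `m i ∘ l` is proper on `A` near `a`* (compact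
preimages of compact subsets of an open base set `V' ∋ (m i ∘ l) a` inside an open `V ∋ a`).

## The proof

The printed proof ([Chirka1989, p. 34]) intersects, over the finitely many projections, the
*open dense* subsets of `U(n)` of coordinate changes that are good for one projection
([Chirka1989, §3.4 Lemma 1]). The tree already contains the existence half of Lemma 1 in the
form of **isolating planes** (`Literature.Geometry.Kaehler.SCV.exists_isolating`,
`Literature/Geometry/Kaehler/AnalyticSetIsolatingPlanes.lean`, resting on the local analytic covers of
`Literature/Analysis/Complex/AnalyticCover.lean`): a `k`-plane `L`, `k = dim E - p`, with `a` isolated in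
`A ∩ (a + L)`, hence ([Chirka1989, §3.1 (5)], `Literature.Analysis.Complex.SCV.exists_coverSetup`) linear
coordinates `Θ : E ≃ C × ℂᵏ` and a closed tube `ball × closedBall` around `a` over whose base `A`
has no points on the rim of the fibre ball (`exists_rim`), which makes the base projection proper
on the open tube ([Chirka1989, §3.1 (3)], `isCompact_inter_tube`). Instead of density we use an
explicit squeeze towards this one plane, so that only the (elementary) openness of the rim
condition is needed:

* `exists_common_complement` — finitely many subspaces of the same dimension have a common
  complement (here: `C`, common to `L` and all kernels `ker (m i)`); with
  `exists_forall_notMem_of_ne_top` (finitely many proper subspaces do not cover `E`);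
* `exists_equiv_adapted_of_isCompl` — coordinates `Θ : E ≃ C × ℂᵏ` adapted to `E = C ⊕ L`;
* `exists_graph_of_inf_eq_bot` — each `ker (m i)`, being transverse to `C`, is a graph
  `{(Θ x).1 = β_i (Θ x).2}` over `L`;
* the automorphism `l` dilates the `C`-coordinate by `ε⁻¹`, so that `ker (m i ∘ l)` is the graph
  of `ε β_i`, uniformly close to `L` for small `ε`;
* `exists_shear` — the rim condition survives the shear `(z, w) ↦ (z - ε β_i w, w)` straightening
  this graph (with half the base radius), and `isCompact_inter_tube` gives properness of the new
  base projection, which differs from `m i ∘ l` only by an isomorphism of the bases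
  (`exists_equiv_comp_eq_of_ker_eq`).

The unitary group of the source is thus replaced by `GL(E)` exactly as in the vendored statement;
nothing here depends on an inner product.

## References

* E. M. Chirka, *Complex Analytic Sets*, Kluwer (1989), Ch. 1 §3.1 (proper maps, (3) and (5)),
  §3.4 Lemma 1 and Lemma 2 (p. 34), §3.5 [Chirka1989].
-/

open Complex Metric Set Filter Function
open scoped Topology Manifold

namespace Literature.Geometry.Kaehler

variable {E : Type*} [NormedAddCommGroup E] [NormedSpace ℂ E]

namespace SCV

/-! ### Linear algebra: common complements -/

section CommonComplement

variable [FiniteDimensional ℂ E]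

/-- Finitely many proper subspaces of a finite-dimensional complex normed space do not cover it.
[folklore] -/
theorem exists_forall_notMem_of_ne_top {ι : Type*} [Finite ι] (K : ι → Submodule ℂ E)
    (hK : ∀ i, K i ≠ ⊤) : ∃ v : E, ∀ i, v ∉ K i := by
  haveI : CompleteSpace E := FiniteDimensional.complete ℂ E
  haveI : Countable ι := Finite.to_countable
  have hd : Dense (⋂ i, ((K i : Set E)ᶜ)) :=
    dense_iInter_of_isOpen (fun i => (Submodule.closed_of_finiteDimensional (K i)).isOpen_compl)
      fun i => dense_compl_of_ne_top (hK i)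
  obtain ⟨v, hv⟩ := hd.nonempty
  exact ⟨v, fun i => (mem_iInter.1 hv i)⟩

/-- **Common complements.** Finitely many subspaces `K i` of the same dimension `dim E - q` of a
finite-dimensional complex vector space have a common complement: a subspace `C` of dimension
`q` with `K i ∩ C = 0` for all `i` (induction on `q`, adding to all `K i` a common vector outside
all of them). [folklore] -/
theorem exists_common_complement {ι : Type*} [Finite ι] [Nonempty ι] :
    ∀ (q : ℕ) (K : ι → Submodule ℂ E), (∀ i, Module.finrank ℂ (K i) + q = Module.finrank ℂ E) →
      ∃ C : Submodule ℂ E, Module.finrank ℂ C = q ∧ ∀ i, K i ⊓ C = ⊥ := by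
  intro q
  induction q with
  | zero =>
    intro K _
    exact ⟨⊥, finrank_bot ℂ E, fun i => inf_bot_eq _⟩
  | succ q ih =>
    intro K hK
    have hne : ∀ i, K i ≠ ⊤ := by
      intro i htop
      have h := hK i
      rw [htop, finrank_top] at h
      omega
    obtain ⟨v, hv⟩ := exists_forall_notMem_of_ne_top K hne
    obtain ⟨i₀⟩ := ‹Nonempty ι›
    have hv0 : v ≠ 0 := fun h => hv i₀ (h ▸ (K i₀).zero_mem)
    -- enlarge every `K i` by the line through `v`
    set K' : ι → Submodule ℂ E := fun i => K i ⊔ (ℂ ∙ v) with hK'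
    have hdisj : ∀ i, K i ⊓ (ℂ ∙ v) = ⊥ := fun i =>
      disjoint_iff.1 ((Submodule.disjoint_span_singleton' hv0).2 (hv i))
    have hK'dim : ∀ i, Module.finrank ℂ (K' i) + q = Module.finrank ℂ E := by
      intro i
      have h1 := Submodule.finrank_sup_add_finrank_inf_eq (K i) (ℂ ∙ v)
      rw [hdisj i, finrank_bot, add_zero, finrank_span_singleton hv0] at h1
      have h2 := hK i
      show Module.finrank ℂ ↥(K i ⊔ (ℂ ∙ v)) + q = Module.finrank ℂ E
      omega
    obtain ⟨C', hC'dim, hC'⟩ := ih K' hK'dim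
    have hvC' : v ∉ C' := by
      intro hvC
      have hmem : v ∈ K' i₀ ⊓ C' := ⟨Submodule.mem_sup_right (Submodule.mem_span_singleton_self v), hvC⟩
      rw [hC' i₀, Submodule.mem_bot] at hmem
      exact hv0 hmem
    refine ⟨C' ⊔ (ℂ ∙ v), ?_, fun i => ?_⟩
    · have h1 := Submodule.finrank_sup_add_finrank_inf_eq C' (ℂ ∙ v)
      rw [disjoint_iff.1 ((Submodule.disjoint_span_singleton' hv0).2 hvC'), finrank_bot, add_zero,
        finrank_span_singleton hv0, hC'dim] at h1
      exact h1
    · rw [Submodule.eq_bot_iff]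
      rintro x ⟨hxK, hxC⟩
      obtain ⟨c, hc, z, hz, rfl⟩ := Submodule.mem_sup.1 hxC
      obtain ⟨t, rfl⟩ := Submodule.mem_span_singleton.1 hz
      -- `c = (c + t • v) - t • v ∈ K' i ∩ C' = 0`
      have hcK' : c ∈ K' i := by
        have : c + t • v - t • v ∈ K' i :=
          Submodule.sub_mem _ (Submodule.mem_sup_left hxK)
            (Submodule.mem_sup_right (Submodule.smul_mem _ t (Submodule.mem_span_singleton_self v)))
        simpa using this
      have hc0 : c = 0 := by
        have hmem : c ∈ K' i ⊓ C' := ⟨hcK', hc⟩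
        rwa [hC' i, Submodule.mem_bot] at hmem
      subst hc0
      rw [zero_add] at hxK ⊢
      have hmem : t • v ∈ K i ⊓ (ℂ ∙ v) := ⟨hxK, Submodule.smul_mem _ t (Submodule.mem_span_singleton_self v)⟩
      rwa [hdisj i, Submodule.mem_bot] at hmem

end CommonComplement

/-! ### Linear algebra: adapted coordinates with a prescribed complement, graphs, base change -/

section Coordinates

variable [FiniteDimensional ℂ E]

/-- **Adapted coordinates with a prescribed complement.** For an injective linear `ι : ℂᵏ → E`
and a complement `C` of its range, the linear isomorphism `Θ : E ≃ C × ℂᵏ` with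
`Θ (ι w) = (0, w)` and `Θ c = (c, 0)` for `c ∈ C`. [folklore] -/
theorem exists_equiv_adapted_of_isCompl {k : ℕ} (ι : (Fin k → ℂ) →L[ℂ] E)
    (hι : Function.Injective ι) (C : Submodule ℂ E)
    (hLC : IsCompl (LinearMap.range (ι : (Fin k → ℂ) →ₗ[ℂ] E)) C) :
    ∃ Θ : E ≃L[ℂ] (C × (Fin k → ℂ)), (∀ w, Θ (ι w) = (0, w)) ∧ ∀ c : C, Θ c = (c, 0) := by
  set L : Submodule ℂ E := LinearMap.range (ι : (Fin k → ℂ) →ₗ[ℂ] E) with hL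
  set e₁ : (L × C) ≃ₗ[ℂ] E := Submodule.prodEquivOfIsCompl L C hLC with he₁
  set e₂ : (Fin k → ℂ) ≃ₗ[ℂ] L := LinearEquiv.ofInjective (ι : (Fin k → ℂ) →ₗ[ℂ] E) hι with he₂
  set Θₗ : E ≃ₗ[ℂ] (C × (Fin k → ℂ)) :=
    e₁.symm ≪≫ₗ (LinearEquiv.prodComm ℂ L C) ≪≫ₗ ((LinearEquiv.refl ℂ C).prodCongr e₂.symm) with hΘ
  refine ⟨Θₗ.toContinuousLinearEquiv, fun w => ?_, fun c => ?_⟩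
  · have h1 : e₁.symm (ι w) = (e₂ w, 0) := by
      have : (ι w : E) = ((e₂ w : L) : E) := by rw [he₂, LinearEquiv.ofInjective_apply]; rfl
      rw [this, he₁, Submodule.prodEquivOfIsCompl_symm_apply_left]
    show Θₗ (ι w) = (0, w)
    simp only [hΘ, LinearEquiv.trans_apply, h1, LinearEquiv.prodComm_apply, Prod.swap_prod_mk,
      LinearEquiv.prodCongr_apply, LinearEquiv.refl_apply, LinearEquiv.symm_apply_apply]
  · have h1 : e₁.symm (c : E) = (0, c) := by
      rw [he₁, Submodule.prodEquivOfIsCompl_symm_apply_right]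
    show Θₗ c = (c, 0)
    simp only [hΘ, LinearEquiv.trans_apply, h1, LinearEquiv.prodComm_apply, Prod.swap_prod_mk,
      LinearEquiv.prodCongr_apply, LinearEquiv.refl_apply, map_zero]

variable {G F : Type*} [NormedAddCommGroup G] [NormedSpace ℂ G] [FiniteDimensional ℂ G]
  [NormedAddCommGroup F] [NormedSpace ℂ F] [FiniteDimensional ℂ F]

omit [FiniteDimensional ℂ G] in
/-- **A subspace transverse to the first factor is a graph over the second.** In coordinates
`Θ : E ≃ G × F`, a subspace `K` with `dim K = dim F` meeting `Θ⁻¹ (G × 0)` only in `0` is the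
graph `{x | (Θ x).1 = β (Θ x).2}` of a linear map `β : F → G`. [folklore] -/
theorem exists_graph_of_inf_eq_bot (Θ : E ≃L[ℂ] (G × F)) (K : Submodule ℂ E)
    (hK : ∀ x ∈ K, (Θ x).2 = 0 → x = 0) (hdim : Module.finrank ℂ K = Module.finrank ℂ F) :
    ∃ β : F →L[ℂ] G, ∀ x, x ∈ K ↔ (Θ x).1 = β (Θ x).2 := by
  -- the second coordinate restricted to `K` is a linear isomorphism `K ≃ F`
  set f : K →ₗ[ℂ] F :=
    (LinearMap.snd ℂ G F).comp ((Θ.toLinearEquiv : E →ₗ[ℂ] G × F).comp K.subtype) with hf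
  have hfapply : ∀ x : K, f x = (Θ (x : E)).2 := fun x => rfl
  have hfinj : Function.Injective f := by
    intro x y hxy
    have h : f (x - y) = 0 := by rw [map_sub, hxy, sub_self]
    rw [hfapply] at h
    have := hK _ (x - y).2 h
    exact Subtype.ext (sub_eq_zero.1 (by simpa using this))
  set e : K ≃ₗ[ℂ] F := f.linearEquivOfInjective hfinj hdim with he
  have heapply : ∀ x : K, e x = (Θ (x : E)).2 := fun x => rfl
  set βₗ : F →ₗ[ℂ] G :=
    (LinearMap.fst ℂ G F).comp (((Θ.toLinearEquiv : E →ₗ[ℂ] G × F).comp K.subtype).comp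
      (e.symm : F →ₗ[ℂ] K)) with hβ
  have hβapply : ∀ w, βₗ w = (Θ ((e.symm w : K) : E)).1 := fun w => rfl
  refine ⟨LinearMap.toContinuousLinearMap βₗ, fun x => ?_⟩
  rw [LinearMap.coe_toContinuousLinearMap']
  constructor
  · intro hx
    have h1 : e.symm (Θ x).2 = ⟨x, hx⟩ := by
      rw [LinearEquiv.symm_apply_eq, heapply]
    rw [hβapply, h1]
  · intro hx
    set y : K := e.symm (Θ x).2 with hy
    have hy2 : (Θ (y : E)).2 = (Θ x).2 := by rw [← heapply, hy, LinearEquiv.apply_symm_apply]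
    have hy1 : (Θ (y : E)).1 = (Θ x).1 := by rw [hx, hβapply]
    have hyx : (y : E) = x := Θ.injective (Prod.ext hy1 hy2)
    rw [← hyx]
    exact y.2

omit [FiniteDimensional ℂ E] [FiniteDimensional ℂ F] in
/-- **Two linear surjections with the same kernel differ by an isomorphism of the targets.**
[folklore] -/
theorem exists_equiv_comp_eq_of_ker_eq (ℓ₁ : E →L[ℂ] G) (ℓ₂ : E →L[ℂ] F)
    (h₁ : Function.Surjective ℓ₁) (h₂ : Function.Surjective ℓ₂)
    (hker : ∀ x, ℓ₁ x = 0 ↔ ℓ₂ x = 0) : ∃ α : G ≃L[ℂ] F, ∀ x, α (ℓ₁ x) = ℓ₂ x := by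
  obtain ⟨σ, hσ⟩ := (ℓ₁ : E →ₗ[ℂ] G).exists_rightInverse_of_surjective
    (LinearMap.range_eq_top.2 h₁)
  have hσapply : ∀ y, ℓ₁ (σ y) = y := fun y => by
    have := LinearMap.congr_fun hσ y
    simpa using this
  set αₗ : G →ₗ[ℂ] F := (ℓ₂ : E →ₗ[ℂ] F).comp σ with hα
  have hαℓ : ∀ x, αₗ (ℓ₁ x) = ℓ₂ x := by
    intro x
    show ℓ₂ (σ (ℓ₁ x)) = ℓ₂ x
    have h0 : ℓ₁ (σ (ℓ₁ x) - x) = 0 := by rw [map_sub, hσapply, sub_self]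
    have h0' : ℓ₂ (σ (ℓ₁ x) - x) = 0 := (hker _).1 h0
    rwa [map_sub, sub_eq_zero] at h0'
  have hbij : Function.Bijective αₗ := by
    constructor
    · intro y y' hyy'
      have h0 : αₗ (y - y') = 0 := by rw [map_sub, hyy', sub_self]
      have h0' : ℓ₂ (σ (y - y')) = 0 := h0
      have h1 : ℓ₁ (σ (y - y')) = 0 := (hker _).2 h0'
      rw [hσapply] at h1
      exact sub_eq_zero.1 h1
    · intro z
      obtain ⟨x, rfl⟩ := h₂ z
      exact ⟨ℓ₁ x, hαℓ x⟩
  refine ⟨(LinearEquiv.ofBijective αₗ hbij).toContinuousLinearEquiv, fun x => ?_⟩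
  exact hαℓ x

end Coordinates

/-! ### Tubes: proper projections from the rim condition, and its stability under small shears -/

section Tube

variable {Kc : Type*} [NormedAddCommGroup Kc] [NormedSpace ℂ Kc] {k : ℕ}

/-- **The tube argument** ([Chirka1989, §3.1 (3)]): in linear coordinates `Θ : E ≃ Kc × ℂᵏ`, if
the closed tube `ball a₁ ε × closedBall a₂ r` lies in `Θ(Ω)` and the set `A` (closed where it is
analytic, i.e. on `Ω`) has no points over `ball a₁ ε` on the rim `closedBall a₂ r ∖ ball a₂ r`,
then over every compact `K ⊆ ball a₁ ε` the part of `A` in the open tube is compact (the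
projection `x ↦ (Θ x).1` is proper on `A ∩ Θ⁻¹(ball × ball)`). This is the argument of
`exists_proper_projection`, isolated. [Chirka, *Complex Analytic Sets*, §3.1 (3), §3.5]
[folklore] -/
theorem isCompact_inter_tube {A Ω : Set E}
    (hA : ∀ x ∈ Ω, Literature.Analysis.Complex.SCV.IsZeroSetAt A x)
    (Θ : E ≃L[ℂ] (Kc × (Fin k → ℂ))) {a₁ : Kc} {a₂ : Fin k → ℂ} {ε r : ℝ}
    (hsubΩ : ball a₁ ε ×ˢ closedBall a₂ r ⊆ Θ '' Ω)
    (hrim : ∀ x ∈ A, (Θ x).1 ∈ ball a₁ ε → (Θ x).2 ∈ closedBall a₂ r → (Θ x).2 ∈ ball a₂ r)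
    {K : Set Kc} (hK : K ⊆ ball a₁ ε) (hKc : IsCompact K) :
    IsCompact (A ∩ Θ ⁻¹' (ball a₁ ε ×ˢ ball a₂ r) ∩ {x | (Θ x).1 ∈ K}) := by
  set C : Set E := Θ.symm '' (K ×ˢ closedBall a₂ r) with hC
  have hCc : IsCompact C := (hKc.prod (isCompact_closedBall a₂ r)).image Θ.symm.continuous
  have hCΩ : C ⊆ Ω := by
    rintro _ ⟨y, hy, rfl⟩
    obtain ⟨z, hzΩ, hz⟩ := hsubΩ ⟨hK hy.1, hy.2⟩
    rw [← hz, ContinuousLinearEquiv.symm_apply_apply]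
    exact hzΩ
  have heq : A ∩ Θ ⁻¹' (ball a₁ ε ×ˢ ball a₂ r) ∩ {x | (Θ x).1 ∈ K} = A ∩ C := by
    ext x
    constructor
    · rintro ⟨⟨hxA, hxV⟩, hxK⟩
      exact ⟨hxA, Θ x, ⟨hxK, ball_subset_closedBall hxV.2⟩, Θ.symm_apply_apply x⟩
    · rintro ⟨hxA, y, ⟨hy1, hy2⟩, rfl⟩
      have hΘy : Θ (Θ.symm y) = y := Θ.apply_symm_apply y
      have hy1' : y.1 ∈ ball a₁ ε := hK hy1
      have hball : y.2 ∈ ball a₂ r := by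
        have := hrim (Θ.symm y) hxA
        rw [hΘy] at this
        exact this hy1' hy2
      refine ⟨⟨hxA, ?_⟩, ?_⟩
      · show Θ (Θ.symm y) ∈ ball a₁ ε ×ˢ ball a₂ r
        rw [hΘy]
        exact ⟨hy1', hball⟩
      · show (Θ (Θ.symm y)).1 ∈ K
        rw [hΘy]
        exact hy1
  rw [heq]
  refine hCc.of_isClosed_subset ?_ inter_subset_right
  refine isClosed_of_closure_subset fun x hx => ⟨?_, ?_⟩
  · have hxC : x ∈ C := hCc.isClosed.closure_subset (closure_mono inter_subset_right hx)
    exact (hA x (hCΩ hxC)).mem_of_mem_closure (closure_mono inter_subset_left hx)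
  · exact hCc.isClosed.closure_subset (closure_mono inter_subset_right hx)

/-- **Stability of the rim condition under small shears.** If in coordinates `Θ : E ≃ Kc × ℂᵏ`
the set `A` has no points over `ball (Θ a).1 ε` on the rim of the fibre ball of radius `r`, then
the same holds, with `ε / 2` in place of `ε`, in the sheared coordinates
`Θ' x = ((Θ x).1 - γ (Θ x).2, (Θ x).2)` for every linear `γ : ℂᵏ → Kc` with `‖γ‖ r ≤ ε / 2`; the
kernel of the new base projection `x ↦ (Θ' x).1` is the graph `{(Θ x).1 = γ (Θ x).2}`.
(Openness of the set of good projections, [Chirka1989, §3.4 Lemma 1].) [folklore] -/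
theorem exists_shear {A Ω : Set E} (Θ : E ≃L[ℂ] (Kc × (Fin k → ℂ))) {a : E} {ε r : ℝ}
    (hsubΩ : ball (Θ a).1 ε ×ˢ closedBall (Θ a).2 r ⊆ Θ '' Ω)
    (hrim : ∀ x ∈ A, (Θ x).1 ∈ ball (Θ a).1 ε → (Θ x).2 ∈ closedBall (Θ a).2 r →
      (Θ x).2 ∈ ball (Θ a).2 r)
    (γ : (Fin k → ℂ) →L[ℂ] Kc) (hγ : ‖γ‖ * r ≤ ε / 2) :
    ∃ Θ' : E ≃L[ℂ] (Kc × (Fin k → ℂ)),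
      (∀ x, Θ' x = ((Θ x).1 - γ (Θ x).2, (Θ x).2)) ∧
      ball (Θ' a).1 (ε / 2) ×ˢ closedBall (Θ' a).2 r ⊆ Θ' '' Ω ∧
      ∀ x ∈ A, (Θ' x).1 ∈ ball (Θ' a).1 (ε / 2) → (Θ' x).2 ∈ closedBall (Θ' a).2 r →
        (Θ' x).2 ∈ ball (Θ' a).2 r := by
  -- the shear automorphism of `Kc × ℂᵏ` and its inverse
  set S₁ : (Kc × (Fin k → ℂ)) →L[ℂ] (Kc × (Fin k → ℂ)) :=
    (ContinuousLinearMap.fst ℂ Kc (Fin k → ℂ) -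
      γ.comp (ContinuousLinearMap.snd ℂ Kc (Fin k → ℂ))).prod
      (ContinuousLinearMap.snd ℂ Kc (Fin k → ℂ)) with hS₁
  set S₂ : (Kc × (Fin k → ℂ)) →L[ℂ] (Kc × (Fin k → ℂ)) :=
    (ContinuousLinearMap.fst ℂ Kc (Fin k → ℂ) +
      γ.comp (ContinuousLinearMap.snd ℂ Kc (Fin k → ℂ))).prod
      (ContinuousLinearMap.snd ℂ Kc (Fin k → ℂ)) with hS₂
  have hS₁apply : ∀ y, S₁ y = (y.1 - γ y.2, y.2) := fun y => rfl
  have hS₂apply : ∀ y, S₂ y = (y.1 + γ y.2, y.2) := fun y => rfl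
  set S : (Kc × (Fin k → ℂ)) ≃L[ℂ] (Kc × (Fin k → ℂ)) :=
    ContinuousLinearEquiv.equivOfInverse S₁ S₂
      (fun y => by rw [hS₂apply, hS₁apply]; simp)
      (fun y => by rw [hS₁apply, hS₂apply]; simp) with hS
  have hΘ' : ∀ x, (Θ.trans S) x = ((Θ x).1 - γ (Θ x).2, (Θ x).2) := fun x => rfl
  -- the basic estimate
  have hest : ∀ (z : Kc) (w : Fin k → ℂ), dist z ((Θ a).1 - γ (Θ a).2) < ε / 2 →
      dist w (Θ a).2 ≤ r → dist (z + γ w) (Θ a).1 < ε := by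
    intro z w hz hw
    rw [dist_eq_norm] at hz hw ⊢
    have h1 : z + γ w - (Θ a).1 = (z - ((Θ a).1 - γ (Θ a).2)) + γ (w - (Θ a).2) := by
      rw [map_sub]; abel
    rw [h1]
    calc ‖(z - ((Θ a).1 - γ (Θ a).2)) + γ (w - (Θ a).2)‖
        ≤ ‖z - ((Θ a).1 - γ (Θ a).2)‖ + ‖γ (w - (Θ a).2)‖ := norm_add_le _ _
      _ < ε / 2 + ε / 2 := by
          apply add_lt_add_of_lt_of_le hz
          calc ‖γ (w - (Θ a).2)‖ ≤ ‖γ‖ * ‖w - (Θ a).2‖ := γ.le_opNorm _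
            _ ≤ ‖γ‖ * r := mul_le_mul_of_nonneg_left hw (norm_nonneg _)
            _ ≤ ε / 2 := hγ
      _ = ε := by ring
  refine ⟨Θ.trans S, hΘ', ?_, ?_⟩
  · rintro ⟨z, w⟩ ⟨hz, hw⟩
    have hmem : ((z + γ w, w) : Kc × (Fin k → ℂ)) ∈ ball (Θ a).1 ε ×ˢ closedBall (Θ a).2 r :=
      ⟨hest z w hz hw, hw⟩
    obtain ⟨x, hxΩ, hx⟩ := hsubΩ hmem
    refine ⟨x, hxΩ, ?_⟩
    rw [hΘ', hx, Prod.mk.injEq]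
    exact ⟨by simp, rfl⟩
  · intro x hxA hx1 hx2
    refine hrim x hxA ?_ hx2
    have := hest ((Θ x).1 - γ (Θ x).2) (Θ x).2 hx1 hx2
    rwa [sub_add_cancel] at this

/-- **The rim condition in adapted coordinates** (first half of `exists_proper_projection`): if
`a` is isolated in `A ∩ (a + range ι)` and `Θ (ι w) = (0, w)`, there are radii `ε, r > 0` with
the closed tube `ball (Θ a).1 ε × closedBall (Θ a).2 r` inside `Θ(Ω)` over whose base `A` has
no points on the rim of the fibre ball (`exists_coverSetup`).
[Chirka, *Complex Analytic Sets*, §3.1 (3), (5), §3.4 Lemma 1, §3.5] [folklore] -/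
theorem exists_rim {A Ω : Set E} {a : E} (hΩ : IsOpen Ω) (haΩ : a ∈ Ω)
    (hA : ∀ x ∈ Ω, Literature.Analysis.Complex.SCV.IsZeroSetAt A x) (ι : (Fin k → ℂ) →L[ℂ] E)
    (hiso : ∀ᶠ w in 𝓝[≠] (0 : Fin k → ℂ), a + ι w ∉ A)
    (Θ : E ≃L[ℂ] (Kc × (Fin k → ℂ))) (hΘι : ∀ w, Θ (ι w) = (0, w)) :
    ∃ ε r : ℝ, 0 < ε ∧ 0 < r ∧
      ball (Θ a).1 ε ×ˢ closedBall (Θ a).2 r ⊆ Θ '' Ω ∧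
      ∀ x ∈ A, (Θ x).1 ∈ ball (Θ a).1 ε → (Θ x).2 ∈ closedBall (Θ a).2 r →
        (Θ x).2 ∈ ball (Θ a).2 r := by
  set a₁ : Kc := (Θ a).1 with ha₁
  set a₂ : Fin k → ℂ := (Θ a).2 with ha₂
  have hΘa : Θ a = (a₁, a₂) := rfl
  have hΩ' : IsOpen (Θ '' Ω) := Θ.toHomeomorph.isOpenMap Ω hΩ
  cases k with
  | zero =>
    obtain ⟨ε, hε, hball⟩ := Metric.isOpen_iff.1 hΩ' (Θ a) (mem_image_of_mem Θ haΩ)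
    refine ⟨ε, 1, hε, one_pos, fun x hx => hball ?_, fun x _ _ _ => ?_⟩
    · rw [mem_ball, Prod.dist_eq, hΘa]
      have h2 : dist x.2 a₂ = 0 := by rw [Subsingleton.elim x.2 a₂, dist_self]
      rw [h2, max_eq_left dist_nonneg]
      exact hx.1
    · rw [mem_ball, Subsingleton.elim (Θ x).2 a₂, dist_self]
      exact one_pos
  | succ k' =>
    obtain ⟨U₀, hU₀o, haU₀, N₀, f, hf, hZU₀⟩ := (hA a haΩ).image_equiv Θ
    set U₁ : Set (Kc × (Fin (k' + 1) → ℂ)) := U₀ ∩ Θ '' Ω with hU₁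
    have hU₁o : IsOpen U₁ := hU₀o.inter hΩ'
    have haU₁ : Θ a ∈ U₁ := ⟨haU₀, mem_image_of_mem Θ haΩ⟩
    have hisoT : ∀ᶠ w in 𝓝[≠] a₂, f (a₁, w) ≠ 0 := by
      have hpt : ∀ w, ((a₁, w) : Kc × (Fin (k' + 1) → ℂ)) = Θ (a + ι (w - a₂)) := by
        intro w
        rw [map_add, hΘι, hΘa, Prod.mk_add_mk, add_zero, add_sub_cancel]
      have ht : Tendsto (fun w : Fin (k' + 1) → ℂ => w - a₂) (𝓝[≠] a₂) (𝓝[≠] 0) := by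
        refine tendsto_nhdsWithin_of_tendsto_nhds_of_eventually_within _ ?_ ?_
        · have : Tendsto (fun w : Fin (k' + 1) → ℂ => w - a₂) (𝓝 a₂) (𝓝 (a₂ - a₂)) :=
            (continuous_id.sub continuous_const).continuousAt
          rw [sub_self] at this
          exact this.mono_left nhdsWithin_le_nhds
        · exact eventually_nhdsWithin_of_forall fun w hw h0 => hw (sub_eq_zero.1 h0)
      have hmemU₀ : ∀ᶠ w in 𝓝[≠] a₂, ((a₁, w) : Kc × (Fin (k' + 1) → ℂ)) ∈ U₀ := by
        have hc : Continuous fun w : Fin (k' + 1) → ℂ => ((a₁, w) : Kc × (Fin (k' + 1) → ℂ)) := by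
          fun_prop
        exact nhdsWithin_le_nhds (hc.continuousAt.preimage_mem_nhds (hU₀o.mem_nhds (hΘa ▸ haU₀)))
      filter_upwards [ht.eventually hiso, hmemU₀] with w hw hwU₀ hf0
      apply hw
      have hmem : ((a₁, w) : Kc × (Fin (k' + 1) → ℂ)) ∈ (Θ '' A) ∩ U₀ := by
        rw [hZU₀]; exact ⟨hwU₀, hf0⟩
      obtain ⟨z, hzA, hz⟩ := hmem.1
      rw [hpt w] at hz
      exact Θ.injective hz ▸ hzA
    obtain ⟨ε, r, C, F, rr, RR, hS, hsubU₁⟩ :=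
      Literature.Analysis.Complex.SCV.exists_coverSetup hU₁o (hf.mono inter_subset_left) haU₁ hisoT
    refine ⟨ε, r, hS.ε_pos, hS.r_pos, fun x hx => (hsubU₁ hx).2, fun x hxA hx1 hx2 => ?_⟩
    have hmem : Θ x ∈ ball a₁ ε ×ˢ closedBall a₂ r := ⟨hx1, hx2⟩
    have hf0 : f (Θ x) = 0 := (hZU₀.subset ⟨mem_image_of_mem Θ hxA, (hsubU₁ hmem).1⟩).2
    exact hS.mem_ball_of_zero hmem hf0

end Tube

/-! ### Chirka §3.4 Lemma 2: the discharge -/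

section Main

variable (E) in
/-- **Existence of proper projections** [Chirka1989, §3.4 Lemma 2, p. 34], discharge of the
named fact `exists_continuousLinearEquiv_forall_isCompact_inter_preimage`. *Proof.* (The printed
proof intersects, over the finitely many projections, the open dense sets of good unitary
coordinate changes of [Chirka1989, §3.4 Lemma 1]; here the density half is replaced by an
explicit squeeze towards one good plane, so that only the — elementary — openness half is
needed.) Let `k = n - p`. By `exists_isolating_plane` ([Chirka1989, §3.4 Lemma 1 / §3.5
Prop. 1], from the local analytic covers of `AnalyticCover.lean`) there is one `k`-plane
`L = range ι₀` with `a` isolated in `A ∩ (a + L)`. The kernels `K_i = ker m_i` are `k`-planes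
too; let `C` be a common complement of `L` and all `K_i` (`exists_common_complement`) and
`Θ : E ≃ C × ℂᵏ` the coordinates adapted to `E = C ⊕ L` (`exists_equiv_adapted_of_isCompl`).
In these coordinates `A` has no points on the rim of a closed tube around `a` (`exists_rim`,
i.e. `exists_coverSetup`, [Chirka1989, §3.1 (5)]), and each `K_i`, being transverse to `C`, is
the graph of a linear `β_i : ℂᵏ → C` (`exists_graph_of_inf_eq_bot`). Let `l` be the
automorphism dilating the `C`-coordinate by `ε⁻¹`; then `ker (m_i ∘ l) = l⁻¹ K_i` is the graph
of `ε β_i`, and for `ε` small the rim condition survives the shear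
`(z, w) ↦ (z - ε β_i w, w)` making this graph vertical (`exists_shear`). The tube argument of
[Chirka1989, §3.1 (3)] (`isCompact_inter_tube`) then shows that the base projection of the
sheared coordinates — which differs from `m_i ∘ l` by an isomorphism of the bases
(`exists_equiv_comp_eq_of_ker_eq`) — is proper on `A` over a small ball.
[cite: Chirka1989, §3.4 Lemma 2, p. 34] -/
theorem exists_continuousLinearEquiv_forall_isCompact_inter_preimage_holds :
    exists_continuousLinearEquiv_forall_isCompact_inter_preimage E := by
  intro _ ι _ p m Ω A a hm hΩ hAΩ hA haA hdim
  classical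
  set n := Module.finrank ℂ E with hn
  -- no projections: nothing to prove
  rcases isEmpty_or_nonempty ι with hι | hι
  · exact ⟨ContinuousLinearEquiv.refl ℂ E, fun i => (IsEmpty.false i).elim⟩
  obtain ⟨i₀⟩ := hι
  have hpn : p ≤ n := by
    have h := finrank_ker_of_surjective (m i₀ : E →ₗ[ℂ] (Fin p → ℂ)) (hm i₀)
    omega
  have haΩ : a ∈ Ω := hAΩ haA
  -- model-space forms of the hypotheses
  have hAz : ∀ y ∈ Ω, Literature.Analysis.Complex.SCV.IsZeroSetAt A y := fun y hy =>
    Literature.Analysis.Complex.SCV.isZeroSetAt_iff_isAnalyticSetAt.2 (hA y hy)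
  have hdim' : ∀ᶠ x in 𝓝 a, x ∈ A → ∀ q, IsRegPt A q x → Module.finrank ℂ E ≤ q + p := by
    obtain ⟨W, hW, hWdim⟩ := hdim
    filter_upwards [hW] with x hxW hxA q hq
    have hq' : IsRegularPointOfCodim 𝓘(ℂ, E) A q x := isRegularPointOfCodim_iff_isRegPt.2 hq
    exact hWdim x ⟨hxW, hxA, q, hq'⟩ q hq'
  -- one isolating `k`-plane `L = range ι₀`, `k = n - p`
  obtain ⟨k, hk⟩ : ∃ k : ℕ, k + p = n := ⟨n - p, by omega⟩
  obtain ⟨ι₀, hι₀, -, hiso⟩ := exists_isolating (hAz a haΩ) haA hdim' ⊥ (by simp) k hk.le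
  set L : Submodule ℂ E := LinearMap.range (ι₀ : (Fin k → ℂ) →ₗ[ℂ] E) with hL
  have hLdim : Module.finrank ℂ L = k := by
    rw [hL, LinearMap.finrank_range_of_inj hι₀, Module.finrank_fin_fun]
  -- the kernels `K i`, and a common complement `C` of `L` and all `K i`
  set Kf : Option ι → Submodule ℂ E := fun j =>
    j.elim L fun i => LinearMap.ker (m i : E →ₗ[ℂ] (Fin p → ℂ)) with hKf
  have hKfdim : ∀ j, Module.finrank ℂ (Kf j) + p = n := by
    rintro (_ | i)
    · show Module.finrank ℂ L + p = n
      omega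
    · exact finrank_ker_of_surjective _ (hm i)
  obtain ⟨C, hCdim, hC⟩ := exists_common_complement p Kf hKfdim
  have hLC : IsCompl L C := isCompl_of_inf_eq_bot_of_finrank_add_eq (hC none) (by omega)
  have hKC : ∀ i, LinearMap.ker (m i : E →ₗ[ℂ] (Fin p → ℂ)) ⊓ C = ⊥ := fun i => hC (some i)
  -- coordinates adapted to `E = C ⊕ L`
  obtain ⟨Θ, hΘι, hΘC⟩ := exists_equiv_adapted_of_isCompl ι₀ hι₀ C hLC
  have hΘ2 : ∀ x : E, (Θ x).2 = 0 → x ∈ C := by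
    intro x hx
    have h : Θ x = Θ ((Θ x).1 : E) := by
      rw [hΘC, Prod.ext_iff]
      exact ⟨rfl, hx⟩
    rw [Θ.injective h]
    exact ((Θ x).1).2
  -- the rim condition around `a`
  obtain ⟨ε₀, r, hε₀, hr, hsubΩ, hrim⟩ := exists_rim hΩ haΩ hAz ι₀ hiso Θ hΘι
  -- the kernels as graphs over `L`
  have hgraph : ∀ i, ∃ β : (Fin k → ℂ) →L[ℂ] C, ∀ x, m i x = 0 ↔ (Θ x).1 = β (Θ x).2 := by
    intro i
    have hKdim : Module.finrank ℂ (LinearMap.ker (m i : E →ₗ[ℂ] (Fin p → ℂ))) =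
        Module.finrank ℂ (Fin k → ℂ) := by
      rw [Module.finrank_fin_fun]
      have := finrank_ker_of_surjective _ (hm i)
      omega
    have htrans : ∀ x ∈ LinearMap.ker (m i : E →ₗ[ℂ] (Fin p → ℂ)), (Θ x).2 = 0 → x = 0 := by
      intro x hx hx2
      have hmem : x ∈ LinearMap.ker (m i : E →ₗ[ℂ] (Fin p → ℂ)) ⊓ C := ⟨hx, hΘ2 x hx2⟩
      rwa [hKC i, Submodule.mem_bot] at hmem
    obtain ⟨β, hβ⟩ :=
      exists_graph_of_inf_eq_bot Θ (LinearMap.ker (m i : E →ₗ[ℂ] (Fin p → ℂ))) htrans hKdim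
    exact ⟨β, fun x => by rw [← hβ x, LinearMap.mem_ker, ContinuousLinearMap.coe_coe]⟩
  choose β hβ using hgraph
  -- the dilation parameter `ε`, with `ε ‖β i‖ r ≤ ε₀ / 2` for all `i`
  set Sβ : ℝ := ∑ i, ‖β i‖ with hSβ
  have hSβ0 : 0 ≤ Sβ := Finset.sum_nonneg fun j _ => norm_nonneg (β j)
  have hden : 0 < r * Sβ + 1 := by positivity
  set ε : ℝ := ε₀ / (2 * (r * Sβ + 1)) with hε
  have hεpos : 0 < ε := by positivity
  have hεβ : ∀ i, ε * ‖β i‖ * r ≤ ε₀ / 2 := by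
    intro i
    have hi : ‖β i‖ ≤ Sβ :=
      Finset.single_le_sum (fun j _ => norm_nonneg (β j)) (Finset.mem_univ i)
    calc ε * ‖β i‖ * r = ε * (r * ‖β i‖) := by ring
      _ ≤ ε * (r * Sβ) := mul_le_mul_of_nonneg_left (mul_le_mul_of_nonneg_left hi hr.le) hεpos.le
      _ ≤ ε * (r * Sβ + 1) := mul_le_mul_of_nonneg_left (le_add_of_nonneg_right zero_le_one) hεpos.le
      _ = ε₀ / 2 := by
          rw [hε]
          field_simp
  have hεC : (ε : ℂ) ≠ 0 := by exact_mod_cast hεpos.ne'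
  -- the automorphism `l`: dilating the `C`-coordinate by `ε⁻¹`
  set sc : C ≃L[ℂ] C :=
    ContinuousLinearEquiv.equivOfInverse ((ε : ℂ)⁻¹ • ContinuousLinearMap.id ℂ C)
      ((ε : ℂ) • ContinuousLinearMap.id ℂ C)
      (fun c => by
        show (ε : ℂ) • ((ε : ℂ)⁻¹ • c) = c
        rw [smul_smul, mul_inv_cancel₀ hεC, one_smul])
      (fun c => by
        show (ε : ℂ)⁻¹ • ((ε : ℂ) • c) = c
        rw [smul_smul, inv_mul_cancel₀ hεC, one_smul]) with hsc
  have hscapply : ∀ c : C, sc c = (ε : ℂ)⁻¹ • c := fun c => rfl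
  set l : E ≃L[ℂ] E :=
    Θ.trans ((sc.prodCongr (ContinuousLinearEquiv.refl ℂ (Fin k → ℂ))).trans Θ.symm) with hl
  have hΘl : ∀ x, Θ (l x) = ((ε : ℂ)⁻¹ • (Θ x).1, (Θ x).2) := by
    intro x
    show Θ (Θ.symm ((sc.prodCongr (ContinuousLinearEquiv.refl ℂ (Fin k → ℂ))) (Θ x))) = _
    rw [ContinuousLinearEquiv.apply_symm_apply, ContinuousLinearEquiv.prodCongr_apply, hscapply]
    rfl
  refine ⟨l, fun i => ?_⟩
  -- `ker (m i ∘ l)` is the graph of `γ = ε β i`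
  set γ : (Fin k → ℂ) →L[ℂ] C := (ε : ℂ) • β i with hγ
  have hγnorm : ‖γ‖ * r ≤ ε₀ / 2 := by
    have h1 : ‖γ‖ ≤ ε * ‖β i‖ := by
      refine ContinuousLinearMap.opNorm_le_bound γ (by positivity) fun w => ?_
      show ‖(ε : ℂ) • β i w‖ ≤ ε * ‖β i‖ * ‖w‖
      rw [norm_smul, Complex.norm_real, Real.norm_of_nonneg hεpos.le, mul_assoc]
      exact mul_le_mul_of_nonneg_left ((β i).le_opNorm w) hεpos.le
    calc ‖γ‖ * r ≤ ε * ‖β i‖ * r := mul_le_mul_of_nonneg_right h1 hr.le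
      _ ≤ ε₀ / 2 := hεβ i
  have hker : ∀ x, m i (l x) = 0 ↔ (Θ x).1 = γ (Θ x).2 := by
    intro x
    rw [hβ i (l x), hΘl x]
    change (ε : ℂ)⁻¹ • (Θ x).1 = β i (Θ x).2 ↔ (Θ x).1 = (ε : ℂ) • β i (Θ x).2
    constructor
    · intro h
      rw [← h, smul_smul, mul_inv_cancel₀ hεC, one_smul]
    · intro h
      rw [h, smul_smul, inv_mul_cancel₀ hεC, one_smul]
  -- sheared coordinates adapted to `ker (m i ∘ l)`, and the tube
  obtain ⟨Θ', hΘ'apply, hsubΩ', hrim'⟩ := exists_shear Θ hsubΩ hrim γ hγnorm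
  set V : Set E := Θ' ⁻¹' (ball (Θ' a).1 (ε₀ / 2) ×ˢ ball (Θ' a).2 r) with hV
  have hVo : IsOpen V := (isOpen_ball.prod isOpen_ball).preimage Θ'.continuous
  have haV : a ∈ V := ⟨mem_ball_self (half_pos hε₀), mem_ball_self hr⟩
  -- base change from `x ↦ (Θ' x).1` to `m i ∘ l` (same kernel)
  set ℓ₁ : E →L[ℂ] C :=
    (ContinuousLinearMap.fst ℂ C (Fin k → ℂ)).comp (Θ' : E →L[ℂ] C × (Fin k → ℂ)) with hℓ₁
  have hℓ₁apply : ∀ x, ℓ₁ x = (Θ' x).1 := fun x => rfl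
  set φ : E →L[ℂ] (Fin p → ℂ) := (m i).comp (l : E →L[ℂ] E) with hφ
  have hφapply : ∀ x, φ x = m i (l x) := fun x => rfl
  have hℓ₁s : Function.Surjective ℓ₁ := Prod.fst_surjective.comp Θ'.surjective
  have hφs : Function.Surjective φ := (hm i).comp l.surjective
  have hkerEq : ∀ x, ℓ₁ x = 0 ↔ φ x = 0 := by
    intro x
    rw [hℓ₁apply, hφapply, hker x, hΘ'apply]
    exact sub_eq_zero
  obtain ⟨α, hα⟩ := exists_equiv_comp_eq_of_ker_eq ℓ₁ φ hℓ₁s hφs hkerEq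
  have hαsymm : ∀ x, α.symm (φ x) = (Θ' x).1 := fun x => by
    rw [← hα x, α.symm_apply_apply, hℓ₁apply]
  refine ⟨V, hVo, haV, α.symm ⁻¹' ball (Θ' a).1 (ε₀ / 2), isOpen_ball.preimage α.symm.continuous,
    fun x hx => ?_, fun K hKV' hKc => ?_⟩
  · show α.symm (φ x) ∈ ball (Θ' a).1 (ε₀ / 2)
    rw [hαsymm]
    exact hx.1
  · have heq : A ∩ V ∩ φ ⁻¹' K =
        A ∩ Θ' ⁻¹' (ball (Θ' a).1 (ε₀ / 2) ×ˢ ball (Θ' a).2 r) ∩ {x | (Θ' x).1 ∈ α.symm '' K} := by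
      ext x
      simp only [mem_inter_iff, mem_preimage, mem_setOf_eq, hV]
      constructor
      · rintro ⟨⟨hxA, hxV⟩, hxK⟩
        exact ⟨⟨hxA, hxV⟩, φ x, hxK, hαsymm x⟩
      · rintro ⟨⟨hxA, hxV⟩, y, hyK, hy⟩
        refine ⟨⟨hxA, hxV⟩, ?_⟩
        have hφx : φ x = y := by
          rw [← hα x, hℓ₁apply, ← hy, ContinuousLinearEquiv.apply_symm_apply]
        rw [hφx]
        exact hyK
    rw [heq]
    refine isCompact_inter_tube hAz Θ' hsubΩ' hrim' (fun y hy => ?_) (hKc.image α.symm.continuous)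
    obtain ⟨z, hz, rfl⟩ := hy
    exact hKV' hz

end Main

end SCV

end Literature.Geometry.Kaehler
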